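import Literature.AlgebraicGeometry.HodgeTheory.DworkSexticReflectionAveraging
import Literature.AlgebraicGeometry.HodgeTheory.GriffithsResidueComparison
import Literature.AlgebraicGeometry.HodgeTheory.FermatEigenspaceHodgeDecomposition
import Literature.AlgebraicGeometry.HodgeTheory.FermatEigenlineHodgeTypesViaResidues
import Literature.AlgebraicGeometry.Motives.GeneralNonsingularForms
import HarnessLib

/-!
# Flat eigenclasses of the Dwork sextic fourfold are of Hodge type `(2,2)`, from Griffiths'
# residue description of the Hodge filtration (Katz 2009, Lemma 3.1(2), purity part)

Family `hodge`, layer `Literature/AlgebraicGeometry/HodgeTheory`; a sequel to `DworkSexticEigenspaces`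
(the eigenclasses `IsEig ψ e c` of `H⁴(X_ψ(ℂ); ℂ)` of the Dwork sextic fourfold
`X_ψ : Σ x_l⁶ − 6ψ ∏ x_l = 0` under `Γ_W = {a ∈ μ₆⁶ : ∏ aₗ = 1}`, `g_a^* c = (∏ aₗ^{eₗ}) c`, and the named
fact `Katz2009_dworkSexticEigenspaces` = Katz 2009 Lemma 3.1) and `DworkSexticReflectionAveraging`
(crux K2 `FlatClassesSpannedByReflectionInvariants` of route `HodgeConjecture/DworkReflectionQuotients`
closed modulo that fact). PROOF FILE: no named fact is introduced; the purity corollary of Katz's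
Lemma 3.1(2) that the route needs — *an eigenclass for one of the four flat exponent types is of Hodge
type `(2,2)`* — is derived here from **Griffiths' description of the Hodge filtration of a smooth
hypersurface by residues** (the tree's named fact `Griffiths1969_residues_span_hodgeFiltration`, Voisin
II Thm. 6.5 / §6.1.3, clauses (ii) `F^{n+1-l}Hⁿ ⊆ res_l(S^{ld-n-2}) + ι^*Hⁿ(ℙⁿ⁺¹)` and (iii) the
naturality `g_a^* res_l(P) = (∏ aᵢ) res_l(P(a • x))` only; Thm. 6.10 / Cor. 6.12 — the Jacobian
ideal — and the ranks of Lemma 3.1(1) are not needed). This is how Katz proves Lemma 3.1 (p. 8: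
"evaluate at the Fermat point … Griffiths"), except that at a general `ψ` we read clause (ii) at pole
order `l = 2` directly: by (iii) the residues `res₂(x^c)`, `Σ cᵢ = 6`, are `Γ_W`-eigenvectors of
character `a ↦ ∏ aᵢ^{cᵢ}` (the factor `∏ aᵢ` of `Ω` is `1` on `Γ_W`), and **no monomial of degree `6`
carries a flat character** `χ_e`, `e ∈ {(1,2,3,3,4,5), (1,2,2,3,5,5), (1,1,2,4,5,5), (1,1,3,3,5,5)}` up to
`𝔖₆` and `e ↦ 6 − e`: `χ_c = χ_e` on `Γ_W` forces `c ≡ e + r·𝟙 (mod 6)` and then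
`Σ cᵢ ≥ Σᵢ ((eᵢ + r) mod 6) ≥ 12` (a `decide`). Hence the isotypic projector `π_e` kills
`res₂(S⁶) + ι^*H⁴(ℙ⁵) ⊇ F³H⁴(X_ψ)`, so `V_e ∩ F³ = 0`, i.e. `V_e` has no `(4,0)` or `(3,1)` part; the
`(1,3)`, `(0,4)` parts vanish by conjugation (`conj V_e ⊆ V_{e⁻¹} = V_{5e}`, Hodge symmetry), and
`V_e = ⊕ (V_e ∩ H^{p,q})` since the `g_a` are automorphisms of the Hodge structure — all of which is the
tree's `pullback_mem_hodgePQ_half_of_eigenspace` (`FermatEigenspaceHodgeDecomposition`).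

Contents: §1 `Γ_W` as a finite subgroup `gammaW ≤ (ℂˣ)⁶` of the diagonal stabiliser of the Dwork form,
its characters `character e : a ↦ ∏ aᵢ^{eᵢ}`, and the bridge `IsEig ψ e c → c ∈ V_{χ_e}`
(`diagonalCharacterEigenspace`); §2 the character count (`exists_translate_of_character_eq`,
`character_ne_of_sum_le`); §3 the vanishing of `V_e ∩ F³H⁴` from clauses (ii)–(iii)
(`eq_zero_of_mem_eigenspace_of_mem_hodgeFiltration_three`) and the purity theorem
`pullback_mem_hodgePQ_two_two_of_griffiths` / `isOfHodgeType_two_two_of_griffiths`; §4 the four flat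
types of the route, and crux K2 granted Griffiths instead of Katz
(`flatClasses_mem_span_reflInvariant_of_griffiths`, same statement as `…_of_katz`).

## References

* N. M. Katz, *Another look at the Dwork family*, Progr. Math. 270 (2009) 89–126, §2 pp. 5–7, §3
  Lemma 3.1 (and its proof, p. 8). [Katz2009]
* P. Griffiths, *On the periods of certain rational integrals I, II*, Ann. of Math. 90 (1969), §8.
  [Griffiths1969]
* C. Voisin, *Hodge Theory and Complex Algebraic Geometry II* (2003), §6.1.2 Thm. 6.5, §6.1.3.
  [VoisinHodgeII2003]
* T. Shioda, *The Hodge conjecture for Fermat varieties*, Math. Ann. 245 (1979), §1 (1.7) (the same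
  reading for the Fermat point). [Shioda1979HodgeFermat]
* J.-P. Serre, *Linear Representations of Finite Groups* (1977), §2.6 Thm. 8. [SerreLinearRepresentations1977]
-/

noncomputable section

open CategoryTheory MvPolynomial Finset
open scoped BigOperators

namespace Literature.AlgebraicGeometry.HodgeTheory.DworkSextic

open Literature.AlgebraicGeometry.Motives Literature.AlgebraicTopology.SingularHomology

/-! ### §1 The group `Γ_W = μ₆⁶ ∩ ker ∏` of diagonal symmetries and its characters -/

/-- **Katz's group `Γ_W`** for the sextic (`W = 𝟙`): the subgroup
`{a ∈ (ℂˣ)⁶ : aᵢ⁶ = 1, ∏ aᵢ = 1}` of diagonal symmetries `xᵢ ↦ aᵢxᵢ` of the Dwork form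
`Σ xᵢ⁶ − 6ψ ∏ xᵢ` (Katz, §2 p. 5: `Γ_W = {ζ ∈ μ_dⁿ : ∏ ζᵢ^{wᵢ} = 1}`). The index type is spelled
`Fin (4 + 2)` (`= Fin 6`) so that instance search sees the same keys as the tree's `n + 2`-indexed
hypersurface API (`diagonalStabilizer`, `diagonalCharacterEigenspace`, `eigenProjector` at `n = 4`).
[cite: Katz2009, §2 p. 5] -/
def gammaW : Subgroup (Fin (4 + 2) → ℂˣ) where
  carrier := {a | (∀ i, a i ^ 6 = 1) ∧ ∏ i, a i = 1}
  mul_mem' := by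
    rintro a b ⟨ha, hap⟩ ⟨hb, hbp⟩
    refine ⟨fun i => ?_, ?_⟩
    · rw [Pi.mul_apply, mul_pow, ha, hb, one_mul]
    · simp only [Pi.mul_apply, Finset.prod_mul_distrib, hap, hbp, one_mul]
  one_mem' := ⟨fun _ => one_pow _, by simp⟩
  inv_mem' := by
    rintro a ⟨ha, hap⟩
    refine ⟨fun i => ?_, ?_⟩
    · rw [Pi.inv_apply, inv_pow, ha, inv_one]
    · simp only [Pi.inv_apply, Finset.prod_inv_distrib, hap, inv_one]

/-- Membership in `Γ_W`: `aᵢ⁶ = 1` for all `i` and `∏ aᵢ = 1`. [cite: Katz2009, §2 p. 5] -/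
theorem mem_gammaW_iff {a : Fin (4 + 2) → ℂˣ} : a ∈ gammaW ↔ (∀ i, a i ^ 6 = 1) ∧ ∏ i, a i = 1 :=
  Iff.rfl

/-- `Γ_W ≤ μ₆⁶` (the tree's `fermatGroup 4 6`). [cite: Katz2009, §2 p. 5] -/
theorem gammaW_le_fermatGroup : gammaW ≤ fermatGroup 4 6 := fun _ ha =>
  mem_fermatGroup_iff.mpr ha.1

/-- `Γ_W` is finite. [folklore] -/
instance instFiniteGammaW : Finite gammaW :=
  Finite.of_injective (Subgroup.inclusion gammaW_le_fermatGroup) (Subgroup.inclusion_injective _)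

/-- (noncomputable `Fintype` structure on `Γ_W`, for the isotypic projectors `|Γ_W|⁻¹ Σ_a …`). [folklore] -/
instance instFintypeGammaW : Fintype gammaW :=
  Fintype.ofFinite _

/-- The values of `a ∈ Γ_W` as a vector of complex numbers satisfy `aᵢ⁶ = 1` (`Γ_W ⊆ μ₆⁶`).
[cite: Katz2009, §2 p. 5] -/
theorem val_pow_six (a : gammaW) (i : Fin 6) : (((a : Fin (4 + 2) → ℂˣ) i : ℂˣ) : ℂ) ^ 6 = 1 := by
  rw [← Units.val_pow_eq_pow_val, (mem_gammaW_iff.mp a.2).1 i, Units.val_one]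

/-- … and `∏ aᵢ = 1` (`W = 𝟙`: `∏ ζᵢ^{wᵢ} = 1`). [cite: Katz2009, §2 p. 5] -/
theorem prod_val_eq_one (a : gammaW) : ∏ i, (((a : Fin (4 + 2) → ℂˣ) i : ℂˣ) : ℂ) = 1 := by
  rw [← Units.coe_prod, (mem_gammaW_iff.mp a.2).2, Units.val_one]

/-- **`Γ_W` stabilises the Dwork form**: `F_ψ(a • x) = F_ψ(x)` for `a ∈ Γ_W` (`Σ (aᵢxᵢ)⁶ = Σ xᵢ⁶` as
`aᵢ⁶ = 1`, `∏ aᵢxᵢ = ∏ xᵢ` as `∏ aᵢ = 1`; Katz §3 p. 92: "`Γ_W` acts as automorphisms of `𝕏/𝔸¹`").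
[cite: Katz2009, §3 p. 92] -/
theorem gammaW_le_diagonalStabilizer (ψ : ℂ) : gammaW ≤ diagonalStabilizer (form ψ) := by
  intro a ha
  have ha6 : ∀ i, ((a i : ℂˣ) : ℂ) ^ 6 = 1 := fun i => by
    rw [← Units.val_pow_eq_pow_val, ha.1 i, Units.val_one]
  have hap : ∏ i, ((a i : ℂˣ) : ℂ) = 1 := by rw [← Units.coe_prod, ha.2, Units.val_one]
  have h1 : ∀ i, aeval (diagonalSubst a) (X i ^ 6 : MvPolynomial (Fin 6) ℂ) = X i ^ 6 := fun i => by
    rw [map_pow, aeval_X, diagonalSubst_apply, mul_pow, ← map_pow, ha6 i, map_one, one_mul]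
  have h2 : aeval (diagonalSubst a) (∏ i, X i : MvPolynomial (Fin 6) ℂ) = ∏ i, X i := by
    rw [map_prod]
    simp only [aeval_X, diagonalSubst_apply]
    rw [Finset.prod_mul_distrib, ← map_prod, hap, map_one, one_mul]
  rw [mem_diagonalStabilizer_iff]
  simp only [form, map_sub, map_sum, map_mul, aeval_C, algebraMap_eq, h1, h2]

/-- **The character `χ_e : Γ_W → ℂˣ`, `a ↦ ∏ aᵢ^{eᵢ}`** of an exponent vector `e` (Katz, §2 p. 5: the
character of `V = e mod 6` is `ζ ↦ ∏ ζᵢ^{vᵢ}`). [cite: Katz2009, §2 pp. 5–7] -/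
def character (e : Fin 6 → ℕ) : gammaW →* ℂˣ where
  toFun a := ∏ i, (a : Fin (4 + 2) → ℂˣ) i ^ e i
  map_one' := by simp
  map_mul' a b := by
    simp only [Subgroup.coe_mul, Pi.mul_apply, mul_pow, Finset.prod_mul_distrib]

/-- `χ_e(a) = ∏ aᵢ^{eᵢ}` in `ℂ`. [cite: Katz2009, §2 p. 5] -/
theorem character_apply_val (e : Fin 6 → ℕ) (a : gammaW) :
    ((character e a : ℂˣ) : ℂ) = ∏ i, (((a : Fin (4 + 2) → ℂˣ) i : ℂˣ) : ℂ) ^ e i := by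
  simp only [character, MonoidHom.coe_mk, OneHom.coe_mk, Units.coe_prod, Units.val_pow_eq_pow_val]

/-- `χ_0 = 1`: the zero exponent vector carries the trivial character of `Γ_W`. [cite: Katz2009, §2 p. 6] -/
theorem character_zero : character (fun _ => 0) = 1 := by
  ext a : 1
  simp [character]

/-- **`χ_e⁻¹ = χ_{5e}`** on `Γ_W` (`aᵢ^{5eᵢ} aᵢ^{eᵢ} = (aᵢ⁶)^{eᵢ} = 1`). [cite: Katz2009, §2 p. 5] -/
theorem character_inv (e : Fin 6 → ℕ) : (character e)⁻¹ = character (fun i => 5 * e i) := by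
  ext a : 1
  rw [MonoidHom.inv_apply, eq_comm, ← mul_eq_one_iff_eq_inv]
  change (∏ i, (a : Fin (4 + 2) → ℂˣ) i ^ (5 * e i)) * ∏ i, (a : Fin (4 + 2) → ℂˣ) i ^ e i = 1
  rw [← Finset.prod_mul_distrib]
  refine Finset.prod_eq_one fun i _ => ?_
  rw [← pow_add, show 5 * e i + e i = 6 * e i by ring, pow_mul, (mem_gammaW_iff.mp a.2).1 i, one_pow]

/-- **The route's eigenclass predicate is membership in `V_{χ_e}`**: `IsEig ψ e c` (pull-back by every
continuous self-map realising some `a ∈ Γ_W` multiplies `c` by `∏ aᵢ^{eᵢ}`) implies that `c` lies in the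
`χ_e`-eigenspace `diagonalCharacterEigenspace (form ψ) Γ_W χ_e` of the tree (`ActsDiagonally` is the
same coordinate clause, `a • v = (aᵢ) * v`). [cite: Katz2009, §2 pp. 5–7] -/
theorem mem_eigenspace_of_isEig {ψ : ℂ} {e : Fin 6 → ℕ} {c : complexBetti (fibre ψ) (2 * 2)}
    (hc : IsEig ψ e c) : c ∈ diagonalCharacterEigenspace (form ψ) gammaW (character e) (2 * 2) := by
  intro a g hg
  have h := hc (fun i => (((a : Fin (4 + 2) → ℂˣ) i : ℂˣ) : ℂ)) (val_pow_six a) (prod_val_eq_one a) g hg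
  rw [h, character_apply_val]

/-! ### §2 Characters of monomials: `χ_c = χ_e` on `Γ_W` forces `c ≡ e + r·𝟙 (mod 6)` -/

/-- The exponents `kⱼ = δ₀ + 5 δⱼ` of the generators `gⱼ = (ζ, 1, …, ζ⁵ (at j), …, 1)` of `Γ_W`.
[folklore] -/
private def genExp (j i : Fin 6) : ℕ := (if i = 0 then 1 else 0) + (if i = j then 5 else 0)

/-- `Σᵢ kⱼ(i) = 6`. [folklore] -/
private theorem sum_genExp (j : Fin 6) : ∑ i, genExp j i = 6 := by
  simp only [genExp, Finset.sum_add_distrib, Finset.sum_ite_eq', Finset.mem_univ, if_true]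

/-- `Σᵢ kⱼ(i) cᵢ = c₀ + 5cⱼ`. [folklore] -/
private theorem sum_genExp_mul (j : Fin 6) (c : Fin 6 → ℕ) : ∑ i, genExp j i * c i = c 0 + 5 * c j := by
  simp only [genExp, add_mul, ite_mul, one_mul, zero_mul, Finset.sum_add_distrib, Finset.sum_ite_eq',
    Finset.mem_univ, if_true]

/-- **`χ_c = χ_e` on `Γ_W` iff `c − e` is constant mod `6`** (the direction used): evaluating at the
elements `gⱼ = (ζ, …, ζ⁵ at j, …) ∈ Γ_W` (`ζ = e^{2πi/6}`) gives `c₀ + 5cⱼ ≡ e₀ + 5eⱼ`, i.e.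
`cⱼ − eⱼ ≡ c₀ − e₀ (mod 6)` (Katz, §2 p. 6: the characters of `Γ_W/Δ` are `(ℤ/d)ⁿ₀` modulo `W`).
[cite: Katz2009, §2 pp. 5–6] -/
theorem exists_translate_of_character_eq {c e : Fin 6 → ℕ} (h : character c = character e) :
    ∃ r : ZMod 6, ∀ i, (c i : ZMod 6) = (e i : ZMod 6) + r := by
  have hζ := Complex.isPrimitiveRoot_exp 6 (by norm_num)
  set u : ℂˣ := (hζ.isUnit (by norm_num)).unit with hu_def
  have hu : IsPrimitiveRoot u 6 := IsPrimitiveRoot.coe_units_iff.mp (by rw [hu_def, IsUnit.unit_spec]; exact hζ)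
  have hu6 : u ^ 6 = 1 := hu.pow_eq_one
  -- the generators `gⱼ`
  have hmem : ∀ j : Fin 6, (fun i => u ^ genExp j i) ∈ gammaW := fun j =>
    ⟨fun i => by rw [← pow_mul, mul_comm, pow_mul, hu6, one_pow],
      by rw [Finset.prod_pow_eq_pow_sum, sum_genExp, hu6]⟩
  have hval : ∀ (j : Fin 6) (d : Fin 6 → ℕ), character d ⟨_, hmem j⟩ = u ^ (d 0 + 5 * d j) := by
    intro j d
    change ∏ i, (u ^ genExp j i) ^ d i = _
    simp_rw [← pow_mul]
    rw [Finset.prod_pow_eq_pow_sum, sum_genExp_mul]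
  have hcong : ∀ j : Fin 6, (c 0 : ZMod 6) + 5 * c j = e 0 + 5 * e j := by
    intro j
    have hj := DFunLike.congr_fun h ⟨_, hmem j⟩
    rw [hval, hval] at hj
    have hmod := (pow_eq_pow_iff_modEq.mp hj)
    rw [← hu.eq_orderOf] at hmod
    have hz := (ZMod.natCast_eq_natCast_iff _ _ 6).mpr hmod
    push_cast at hz
    exact hz
  refine ⟨(c 0 : ZMod 6) - e 0, fun i => ?_⟩
  have h6 : (6 : ZMod 6) = 0 := by decide
  linear_combination (5 : ZMod 6) * hcong i + (-4 * (c i : ZMod 6) + 4 * e i - c 0 + e 0) * h6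

/-- If `c ≡ e + r·𝟙 (mod 6)` then `Σᵢ ((eᵢ + r) mod 6) ≤ Σ cᵢ` (each `cᵢ ≥ cᵢ mod 6 = (eᵢ + r) mod 6`);
`translate e r` is the tree's `e + r·𝟙 mod 6`. [cite: Katz2009, §2 p. 6] -/
theorem sum_translate_val_le {c e : Fin 6 → ℕ} {r : ZMod 6} (h : ∀ i, (c i : ZMod 6) = (e i : ZMod 6) + r) :
    ∑ i, (translate e r i).val ≤ ∑ i, c i := by
  refine Finset.sum_le_sum fun i _ => ?_
  rw [translate, ← h i, ZMod.val_natCast]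
  exact Nat.mod_le _ _

/-- **Character count.** If every translate `e + r·𝟙 (mod 6)` has `Σᵢ ((eᵢ + r) mod 6) > 6`, then no
exponent vector `c` with `Σ cᵢ ≤ 6` — no monomial of degree `≤ 6`, in particular no numerator `x^c` of
a residue `Res(x^c Ω/F²)` and no constant — has character `χ_c = χ_e` on `Γ_W`. This is the counting
step "the eigenline of `V` at the Fermat point is the residue of `∏ Xᵢ^{ṽᵢ−1}Ω/F^{deg V}`" of Katz's
proof of Lemma 3.1(2) read at pole order `2`. [cite: Katz2009, Lemma 3.1 (proof)] -/
theorem character_ne_of_sum_le {e : Fin 6 → ℕ} (hlow : ∀ r : ZMod 6, 6 < ∑ i, (translate e r i).val)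
    {c : Fin 6 → ℕ} (hc : ∑ i, c i ≤ 6) : character c ≠ character e := by
  intro h
  obtain ⟨r, hr⟩ := exists_translate_of_character_eq h
  exact absurd ((hlow r).trans_le ((sum_translate_val_le hr).trans hc)) (lt_irrefl _)

/-- In particular such a `χ_e` is a nontrivial character. [cite: Katz2009, Lemma 3.1] -/
theorem character_ne_one {e : Fin 6 → ℕ} (hlow : ∀ r : ZMod 6, 6 < ∑ i, (translate e r i).val) :
    character e ≠ 1 := by
  rw [← character_zero]
  exact (character_ne_of_sum_le hlow (c := fun _ => 0) (by simp)).symm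

/-! ### §3 Flat eigenspaces meet `F³H⁴(X_ψ)` trivially (Griffiths (ii)–(iii) at pole order `2`) -/

section Griffiths

variable {ψ : ℂ}

/-- **`π_e` kills the residues of degree-`6` numerators.** Let `res : ℂ[x₀,…,x₅] → H⁴(X_ψ(ℂ); ℂ)` be
`ℂ`-linear and equivariant on the sextic forms for the twisted action,
`g_a^* (res P) = (∏ aᵢ) res (P(a • x))`, `a ∈ Γ_W` — as Griffiths' residue map `P ↦ Res(PΩ/F_ψ²)` is
(Voisin II §6.1.3; clause (iii) of `Griffiths1969_residues_span_hodgeFiltration`). If every translate of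
`e` has `Σᵢ ((eᵢ + r) mod 6) > 6`, then `π_e (res P) = res(|Γ_W|⁻¹ Σ_a χ_e(a)⁻¹ P(a • x)) = 0` for `P`
homogeneous of degree `6`: `∏ aᵢ = 1` on `Γ_W`, each monomial `x^c` of `P` is a `χ_c`-eigenvector of
the substitution, and `χ_c ≠ χ_e` (`character_ne_of_sum_le`), so the character sum vanishes
(orthogonality). [cite: Katz2009, Lemma 3.1 (proof)] [cite: VoisinHodgeII2003, §6.1.3]
[cite: SerreLinearRepresentations1977, §2.6 Thm. 8] -/
theorem eigenProjector_res_eq_zero (hG' : gammaW ≤ diagonalStabilizer (form ψ))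
    (res : MvPolynomial (Fin 6) ℂ →ₗ[ℂ] complexBetti (fibre ψ) (2 * 2))
    (hres : ∀ (a : gammaW) (P : MvPolynomial (Fin 6) ℂ), P.IsHomogeneous 6 →
      singularCohomology.map ℂ ℂ (diagonalMap (form ψ) (hG' a.2)) (2 * 2) (res P) =
        (∏ i, (((a : Fin (4 + 2) → ℂˣ) i : ℂˣ) : ℂ)) • res (aeval (diagonalSubst (a : Fin (4 + 2) → ℂˣ)) P))
    {e : Fin 6 → ℕ} (hlow : ∀ r : ZMod 6, 6 < ∑ i, (translate e r i).val)
    {P : MvPolynomial (Fin 6) ℂ} (hP : P.IsHomogeneous 6) :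
    eigenProjector (form ψ) (character e) (2 * 2) hG' (res P) = 0 := by
  rw [eigenProjector_apply]
  simp_rw [hres _ P hP, prod_val_eq_one, one_smul, ← map_smul res, ← map_sum res]
  suffices h : ∑ a : gammaW, ((character e a : ℂˣ) : ℂ)⁻¹ •
      aeval (diagonalSubst (a : Fin (4 + 2) → ℂˣ)) P = 0 by
    rw [h, map_zero, smul_zero]
  have hexp : ∀ a : gammaW, aeval (diagonalSubst (a : Fin (4 + 2) → ℂˣ)) P =
      ∑ c ∈ P.support, ((character c a : ℂˣ) : ℂ) • monomial c (coeff c P) := by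
    intro a
    conv_lhs => rw [P.as_sum]
    rw [map_sum]
    refine Finset.sum_congr rfl fun c _ => ?_
    rw [aeval_diagonalSubst_monomial, character_apply_val]
  simp_rw [hexp, Finset.smul_sum, smul_smul]
  rw [Finset.sum_comm]
  refine Finset.sum_eq_zero fun c hc => ?_
  rw [← Finset.sum_smul]
  have hdeg : c.degree = 6 := by
    by_contra h
    exact (mem_support_iff.mp hc) (hP.coeff_eq_zero h)
  have hsum6 : ∑ i, c i ≤ 6 := by rw [← Finsupp.degree_eq_sum, hdeg]
  have hne : character c ≠ character e := character_ne_of_sum_le hlow hsum6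
  have hθ : character c * (character e)⁻¹ ≠ 1 := fun h1 => hne (mul_inv_eq_one.mp h1)
  have hsum : ∑ a : gammaW, ((character e a : ℂˣ) : ℂ)⁻¹ * ((character c a : ℂˣ) : ℂ) = 0 := by
    rw [← sum_apply_monoidHom_eq_zero hθ]
    refine Finset.sum_congr rfl fun a _ => ?_
    rw [MonoidHom.mul_apply, MonoidHom.inv_apply, Units.val_mul, Units.val_inv_eq_inv_val, mul_comm]
  rw [hsum, zero_smul]

/-- **A flat eigenspace meets `F³H⁴(X_ψ)` trivially** (`ψ⁶ ≠ 1`), granted Griffiths' residue description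
of the Hodge filtration (the named fact `Griffiths1969_residues_span_hodgeFiltration`, Voisin II
Thm. 6.5 / §6.1.3, at `n = 4`, `d = 6`, pole order `l = 2`): if every translate of `e` has
`Σᵢ ((eᵢ + r) mod 6) > 6` and `x ∈ V_{χ_e}` pulls back into `F³` of the Hodge model `A`, then `x = 0`.
Indeed (ii) `x = res₂(P) + ι^* y`, `deg P = 6`, and `x = π_e x = π_e res₂(P) + π_e ι^* y = 0 + 0`:
`π_e` kills `res₂(S⁶)` (`eigenProjector_res_eq_zero`, fed with (iii)) and the `Γ_W`-INVARIANT ambient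
classes `ι^* H⁴(ℙ⁵(ℂ))` (`map_diagonalMap_map_hypersurfaceι`), `χ_e ≠ 1`. This is the `(4,0) + (3,1)`
half of Katz's Lemma 3.1(2) for flat `e` ("evaluate … Griffiths", p. 8), at a general `ψ`.
[cite: Katz2009, Lemma 3.1(2)] [cite: VoisinHodgeII2003, §6.1.2 Thm. 6.5 and §6.1.3] -/
theorem eq_zero_of_mem_eigenspace_of_mem_hodgeFiltration_three
    (hG : Griffiths1969_residues_span_hodgeFiltration) (hψ : ψ ^ 6 ≠ 1) (A : HodgeModel 4 (fibre ψ))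
    {e : Fin 6 → ℕ} (hlow : ∀ r : ZMod 6, 6 < ∑ i, (translate e r i).val)
    {x : complexBetti (fibre ψ) (2 * 2)}
    (hx : x ∈ diagonalCharacterEigenspace (form ψ) gammaW (character e) (2 * 2))
    (hxA : A.pullback (2 * 2) x ∈ A.hodgeFiltration (2 * 2) 3) : x = 0 := by
  have hG' := gammaW_le_diagonalStabilizer ψ
  obtain ⟨res, -, hii, hiii⟩ := hG 4 6 (by norm_num) (form ψ) (isHomogeneous_form ψ)
    (fun z hz hFz => (isNonsingularForm_form hψ).exists_eval_pderiv_ne_zero hz hFz)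
    (isSmoothProjective_fibre hψ) A
  have h2 := hii 2 (by norm_num) (by norm_num) x hxA
  obtain ⟨u, hu, v, hv, huv⟩ := Submodule.mem_sup.mp h2
  obtain ⟨y, rfl⟩ := LinearMap.mem_range.mp hv
  have hπx : eigenProjector (form ψ) (character e) (2 * 2) hG' x = x :=
    eigenProjector_apply_of_mem _ hG' hx
  -- `π_e` kills the residue part
  have hπu : eigenProjector (form ψ) (character e) (2 * 2) hG' u = 0 := by
    have hker : (⨆ (k : ℕ) (_ : k + (4 + 2) = 2 * 6),
        (MvPolynomial.homogeneousSubmodule (Fin (4 + 2)) ℂ k).map (res 2)) ≤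
          LinearMap.ker (eigenProjector (form ψ) (character e) (2 * 2) hG') := by
      refine iSup₂_le fun k hk => Submodule.map_le_iff_le_comap.mpr fun P hP => ?_
      rw [Submodule.mem_comap, LinearMap.mem_ker]
      obtain rfl : k = 6 := by omega
      exact eigenProjector_res_eq_zero hG' (res 2)
        (fun a Q hQ => hiii _ (hG' a.2) 2 6 Q (by norm_num) (by norm_num) (by norm_num) hQ) hlow
        ((MvPolynomial.mem_homogeneousSubmodule 6 P).mp hP)
    exact LinearMap.mem_ker.mp (hker hu)
  -- `π_e` kills the ambient classes (`Γ_W` fixes them, `χ_e ≠ 1`)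
  have hπy : eigenProjector (form ψ) (character e) (2 * 2) hG'
      ((complexBetti.map (SmoothHypersurface.hypersurfaceι (form ψ)) 4).hom y) = 0 := by
    have hy : (complexBetti.map (SmoothHypersurface.hypersurfaceι (form ψ)) 4).hom y ∈
        diagonalCharacterEigenspace (form ψ) gammaW 1 (2 * 2) := by
      rw [mem_diagonalCharacterEigenspace_iff_diagonalMap hG']
      intro a
      rw [MonoidHom.one_apply, Units.val_one, one_smul]
      exact map_diagonalMap_map_hypersurfaceι (form ψ) (hG' a.2) 4 y
    exact eigenProjector_apply_of_mem_of_ne _ hG' hy (character_ne_one hlow).symm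
  rw [← hπx, ← huv, map_add, hπu, hπy, add_zero]

/-- The `(p,q)`-parts with `q < p` of a flat eigenspace vanish (they lie in `F³`): the shape of the
hypotheses `h₁`, `h₂` of the tree's `pullback_mem_hodgePQ_half_of_eigenspace`. [cite: Katz2009, Lemma 3.1(2)] -/
theorem eq_zero_of_mem_eigenspace_of_mem_hodgePQ_upper
    (hG : Griffiths1969_residues_span_hodgeFiltration) (hψ : ψ ^ 6 ≠ 1) (A : HodgeModel 4 (fibre ψ))
    {e : Fin 6 → ℕ} (hlow : ∀ r : ZMod 6, 6 < ∑ i, (translate e r i).val) :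
    ∀ i ∈ antidiagonal (2 * 2), i.2 < i.1 →
      ∀ x ∈ diagonalCharacterEigenspace (form ψ) gammaW (character e) (2 * 2),
        A.pullback (2 * 2) x ∈ A.hodgePQ (2 * 2) i.1 i.2 → x = 0 := by
  intro i hi hlt x hx hxA
  have hsum : i.1 + i.2 = 2 * 2 := Finset.HasAntidiagonal.mem_antidiagonal.mp hi
  exact eq_zero_of_mem_eigenspace_of_mem_hodgeFiltration_three hG hψ A hlow hx
    (A.hodgePQ_le_hodgeFiltration hsum (by omega) hxA)

/-- **Purity (Katz 2009, Lemma 3.1(2), for flat characters), from Griffiths.** Let `ψ⁶ ≠ 1` and let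
`e` be an exponent vector all of whose translates `e + r·𝟙`, and all of whose INVERSE's translates
`5e + r·𝟙`, reduce mod `6` to vectors of sum `> 6` (i.e. `≥ 12`: neither `χ_e` nor `χ_e⁻¹ = χ_{5e}`
is carried by a monomial of degree `≤ 6`). Then every `e`-eigenclass of `H⁴(X_ψ(ℂ); ℂ)` pulls back
into `H^{2,2}` of every Hodge model `A`: the `(4,0)`, `(3,1)` parts of `V_e` and of `V_{5e}` vanish
(`eq_zero_of_mem_eigenspace_of_mem_hodgePQ_upper`), hence also the `(1,3)`, `(0,4)` parts of `V_e` by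
conjugation (`conj V_e ⊆ V_{e⁻¹}`, Hodge symmetry), and `V_e` is the sum of its `(p,q)`-parts
(`pullback_mem_hodgePQ_half_of_eigenspace`). Same conclusion as
`Katz2009_dworkSexticEigenspaces.pullback_mem_hodgePQ_two_two`, with the Katz fact replaced by
`Griffiths1969_residues_span_hodgeFiltration`. [cite: Katz2009, Lemma 3.1(2)]
[cite: VoisinHodgeII2003, §6.1.2 Thm. 6.5 and §6.1.3] -/
theorem pullback_mem_hodgePQ_two_two_of_griffiths (hG : Griffiths1969_residues_span_hodgeFiltration)
    (hψ : ψ ^ 6 ≠ 1) (A : HodgeModel 4 (fibre ψ)) {e : Fin 6 → ℕ}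
    (hlow : ∀ r : ZMod 6, 6 < ∑ i, (translate e r i).val)
    (hlow' : ∀ r : ZMod 6, 6 < ∑ i, (translate (fun i => 5 * e i) r i).val)
    {c : complexBetti (fibre ψ) (2 * 2)} (hc : IsEig ψ e c) :
    A.pullback (2 * 2) c ∈ A.hodgePQ (2 * 2) 2 2 :=
  pullback_mem_hodgePQ_half_of_eigenspace (form ψ) (gammaW_le_diagonalStabilizer ψ) (character e)
    (isSmoothProjective_fibre hψ) A (eq_zero_of_mem_eigenspace_of_mem_hodgePQ_upper hG hψ A hlow)
    (fun i hi hlt x hx hxA => by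
      rw [character_inv] at hx
      exact eq_zero_of_mem_eigenspace_of_mem_hodgePQ_upper hG hψ A hlow' i hi hlt x hx hxA)
    (mem_eigenspace_of_isEig hc)

/-- `∃`-model form: under Griffiths' residue theorem such an eigenclass `IsOfHodgeType 4 X_ψ 4 2 2`
(Hodge models exist, `nonempty_hodgeModel_holds`). [cite: Katz2009, Lemma 3.1(2)] -/
theorem isOfHodgeType_two_two_of_griffiths (hG : Griffiths1969_residues_span_hodgeFiltration)
    (hψ : ψ ^ 6 ≠ 1) {e : Fin 6 → ℕ} (hlow : ∀ r : ZMod 6, 6 < ∑ i, (translate e r i).val)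
    (hlow' : ∀ r : ZMod 6, 6 < ∑ i, (translate (fun i => 5 * e i) r i).val)
    {c : complexBetti (fibre ψ) (2 * 2)} (hc : IsEig ψ e c) :
    IsOfHodgeType 4 (fibre ψ) (2 * 2) 2 2 c := by
  obtain ⟨A⟩ := nonempty_hodgeModel_holds (n := 4) (X := fibre ψ) (isSmoothProjective_fibre hψ)
  exact ⟨A, pullback_mem_hodgePQ_two_two_of_griffiths hG hψ A hlow hlow' hc⟩

end Griffiths

/-! ### §4 The route's four flat types; crux K2 granted Griffiths instead of Katz -/

section FlatTypes

/-- Permuting the coordinates does not change the translate sums `Σᵢ ((eᵢ + r) mod 6)` (Katz's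
`deg(V + rW)` is a symmetric function of the coordinates). [cite: Katz2009, Lemma 3.1] -/
theorem sum_translate_val_comp_equiv (e : Fin 6 → ℕ) (σ : Equiv.Perm (Fin 6)) (r : ZMod 6) :
    ∑ i, (translate (fun l => e (σ l)) r i).val = ∑ i, (translate e r i).val :=
  Equiv.sum_comp σ (fun i => (translate e r i).val)

/-- … so the lower bound on translate sums is permutation invariant. [cite: Katz2009, Lemma 3.1] -/
theorem translate_lower_comp_equiv {e : Fin 6 → ℕ} (h : ∀ r : ZMod 6, 6 < ∑ i, (translate e r i).val)
    (σ : Equiv.Perm (Fin 6)) : ∀ r : ZMod 6, 6 < ∑ i, (translate (fun l => e (σ l)) r i).val :=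
  fun r => by rw [sum_translate_val_comp_equiv]; exact h r

/-- **No monomial of degree `≤ 6` carries a flat character**: for each of the four flat types `e`
(`flatTypes`), every translate of `e`, of `5e ≡ −e`, of the conjugate type `6 − e` and of `5(6 − e)`
reduces mod `6` to a vector of sum `> 6` (in fact `12` or `18`; a `decide`). [cite: Katz2009, Lemma 3.1] -/
theorem flatTypes_translate_lower (j : Fin 4) :
    (∀ r : ZMod 6, 6 < ∑ i, (translate (flatTypes j) r i).val) ∧
    (∀ r : ZMod 6, 6 < ∑ i, (translate (fun i => 5 * flatTypes j i) r i).val) ∧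
    (∀ r : ZMod 6, 6 < ∑ i, (translate (fun i => 6 - flatTypes j i) r i).val) ∧
    (∀ r : ZMod 6, 6 < ∑ i, (translate (fun i => 5 * (6 - flatTypes j i)) r i).val) := by
  fin_cases j <;> decide

/-- Hence, under Griffiths' residue theorem, the eigenclasses of the four flat types in every
position `σ`, and of their conjugates `6 − e`, are of Hodge type `(2,2)` (`ψ⁶ ≠ 1`).
[cite: Katz2009, Lemma 3.1(2)] -/
theorem isOfHodgeType_two_two_flatTypes_of_griffiths (hG : Griffiths1969_residues_span_hodgeFiltration)
    {ψ : ℂ} (hψ : ψ ^ 6 ≠ 1) (j : Fin 4) (σ : Equiv.Perm (Fin 6)) {u v : complexBetti (fibre ψ) (2 * 2)}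
    (hu : IsEig ψ (fun l => flatTypes j (σ l)) u) (hv : IsEig ψ (fun l => 6 - flatTypes j (σ l)) v) :
    IsOfHodgeType 4 (fibre ψ) (2 * 2) 2 2 u ∧ IsOfHodgeType 4 (fibre ψ) (2 * 2) 2 2 v := by
  obtain ⟨h1, h2, h3, h4⟩ := flatTypes_translate_lower j
  exact ⟨isOfHodgeType_two_two_of_griffiths hG hψ (translate_lower_comp_equiv h1 σ)
      (translate_lower_comp_equiv h2 σ) hu,
    isOfHodgeType_two_two_of_griffiths hG hψ (translate_lower_comp_equiv h3 σ)
      (translate_lower_comp_equiv h4 σ) hv⟩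

/-- **Crux K2 of route `DworkReflectionQuotients`, granted Griffiths' residue description of the Hodge
filtration** (the named fact `Griffiths1969_residues_span_hodgeFiltration`, Voisin II Thm. 6.5 /
§6.1.3) in place of Katz's Lemma 3.1: for `ψ⁶ ≠ 1`, every type `e` among Katz's four flat types in any
position `σ ∈ 𝔖₆`, and every RATIONAL class `w = u + v` with `u` an eigenclass of exponent `e ∘ σ` and
`v` one of exponent `(6 − e) ∘ σ`, the class `w` lies in the `ℂ`-span of the rational `(2,2)`-classes
invariant under some realised reflection `s_(i,i',ζ)` — `u`, `v` are `(2,2)` by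
`isOfHodgeType_two_two_flatTypes_of_griffiths`, then the six-reflection averaging identity
(`mem_span_reflInvariant_of_isEig_add`). Same statement as `flatClasses_mem_span_reflInvariant_of_katz`.
[cite: Katz2009, Lemma 3.1 and §2 pp. 5–7] [cite: VoisinHodgeII2003, §6.1.2 Thm. 6.5 and §6.1.3]
[cite: BiniGarbagnati2012, §3.4] -/
theorem flatClasses_mem_span_reflInvariant_of_griffiths (hG : Griffiths1969_residues_span_hodgeFiltration)
    {ψ : ℂ} (hψ : ψ ^ 6 ≠ 1) (j : Fin 4) (σ : Equiv.Perm (Fin 6)) (w : complexBetti (fibre ψ) (2 * 2))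
    (hrat : IsRationalClass w)
    (huv : ∃ u v : complexBetti (fibre ψ) (2 * 2), IsEig ψ (fun l => flatTypes j (σ l)) u ∧
      IsEig ψ (fun l => 6 - flatTypes j (σ l)) v ∧ w = u + v) :
    w ∈ Submodule.span ℂ {c : complexBetti (fibre ψ) (2 * 2) | IsRationalClass c ∧
      IsOfHodgeType 4 (fibre ψ) (2 * 2) 2 2 c ∧ ∃ i i' : Fin 6, i ≠ i' ∧ ∃ ζ : ℂ, ζ ^ 6 = 1 ∧
        ∃ g : C(Motives.ComplexPoints (fibre ψ), Motives.ComplexPoints (fibre ψ)),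
          (∀ x, ∃ t : ℂ, (pt ψ (g x)).rep = t • (fun k => if k = i then ζ * (pt ψ x).rep i'
            else if k = i' then ζ⁻¹ * (pt ψ x).rep i else (pt ψ x).rep k)) ∧
          singularCohomology.map ℂ ℂ g (2 * 2) c = c} := by
  obtain ⟨u, v, hu, hv, hw⟩ := huv
  obtain ⟨hne, hne'⟩ := flatTypes_zero_ne_five j
  obtain ⟨hu2, hv2⟩ := isOfHodgeType_two_two_flatTypes_of_griffiths hG hψ j σ hu hv
  have hij : σ.symm 0 ≠ σ.symm 5 := fun h => by simpa using congrArg σ h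
  exact mem_span_reflInvariant_of_isEig_add hψ hij (e := fun l => flatTypes j (σ l))
    (e' := fun l => 6 - flatTypes j (σ l)) (by simpa using hne) (by simpa using hne') hu hv hw hrat
    (hw ▸ hu2.add (isSmoothProjective_fibre hψ) hv2)

end FlatTypes

end Literature.AlgebraicGeometry.HodgeTheory.DworkSextic

end
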